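import Summits.BirchSwinnertonDyer.BirchSwinnertonDyer.Theorems.SchneiderFreeAdditiveX3SemistableTwistLocalAnyLine
import Summits.BirchSwinnertonDyer.BirchSwinnertonDyer.Theorems.SchneiderFreeAdditiveX3TwistThreeResidualPairSwap
import Summits.BirchSwinnertonDyer.BirchSwinnertonDyer.Theorems.CumulativeHeegnerLeopoldtCumulativeHeegnerInclusionAtThreeLineBaseChange
import Summits.BirchSwinnertonDyer.BirchSwinnertonDyer.Theorems.EisensteinPrimesResidualLineRigidity
import Literature.NumberTheory.EllipticCurves.NeronOggShafarevichLocalProofs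
import Literature.NumberTheory.EllipticCurves.GoodReductionUnramifiedProofs
import Literature.NumberTheory.EllipticCurves.Rank1Residual.GVParityTwistTransportProofs
import Literature.NumberTheory.GaloisRepresentations.AbsGaloisOuterConj
import Literature.NumberTheory.GaloisRepresentations.AbsIntegersEquiv
import HarnessLib

/-!
# Route `SchneiderFreeAdditiveX3` (K1 door): GOOD REDUCTION ABOVE `p` OVER A NUMBER FIELD, READ ON `Γ_ℚ` — either `E` is good at `p`,
# or inertia acts on almost every `E[ℓ]` through the sign of `Γ_ℚ / res(Γ_F)`, and then the matching quadratic twist is good at `p`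

Cell `bsd-schneider-ideate`, seat `bsd-schneider-door-c5` (prover, generation 30; assembly layer; `--supports` 19177, helper).
PARTITION: board row B6 ∩ X3 ∩ sst-twist, `r = 1` (7 101 pairs; (G-ord, `e = 2`) half 2 560, of which 2 411 at `p = 3`);
types-the-object-of nothing new; first half of the missing lemma (C5) of generation 29's diagnosis (FINDING-door-c5-g29 §2c);
closes none of B6's cells (BSD NOT advanced).  bears_on: K1-door (items 18971/18972 → 19177 r3 `GordTwoBranchIMC`).

WHY.  Keller–Yin arXiv:2410.23241 Thm. 3.5.1 is typed over `PotOrdSetting`, whose reduction clause is "Case (I)"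
(`HasGoodOrdinaryReductionOverQuadraticAt`: `E` becomes good ordinary above `p` over SOME number field of degree `≤ 2`), while every
local lemma of the door (generations 23–29) consumes a PRESENTATION `W = C • V^{(p*)}`, `V` good ordinary at `p`.  At `p ≥ 5` the tree
passes between the two through Serre's `12 / gcd(12, v_p Δ)` (`Additive.GordDescentField`); at `p = 3` (2 411 of the 2 560 (G-ord) pairs)
nothing did (Kraus's table at `3` is only partly vendored).  This file and its sequel `…QuadraticGoodReductionDescent` prove the passage
for EVERY odd `p` with no discriminant arithmetic, by Galois theory on prime-to-`p` torsion (Serre–Tate: the inertia image of a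
potentially good curve embeds in `Aut` of the special fibre; an involution there is `±1`).

* §1 `smul_eq_neg_of_sq_trivial` — `σ ∈ Γ_ℚ` with `σ²` trivial on `E[ℓ]` (`ℓ` odd prime) and `χ̄_ℓ(σ) = 1` acts on `E[ℓ]` as `+1` or
  `−1` (the determinant is read through generation 28's `intCast_mul_eq_cyclotomic_of_stableLine`).
* §2 `smul_geomTorsion_eq_of_mem_inertia_of_mem_range` — if `E_F` is good at `w ∣ p`, the elements of `I_𝔓 ≤ Γ_ℚ` (`𝔓` the contraction
  of a prime of `\bar ℤ_F` above `w`) coming from `Γ_F` fix `E[n]`, `p ∤ n` (Silverman VII.4.1(a) over `F`, transported).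
* §3 `hasGoodReductionAt_of_infinite_unramifiedTorsion_at` — Néron–Ogg–Shafarevich (d) ⇒ (a) with the inertia group of ONE prime above `v`
  (the tree's local criterion `hasGoodReductionAt_of_infinite_unramifiedTorsion_holds` + conjugation of inertia groups).
* §4 `hasGoodReductionAt_or_forall_inertia_smul_eq_neg` — **THE DICHOTOMY**: with `H = res(Γ_F)` of index `≤ 2`, either `E` is good at `v`,
  or some `σ₀ ∈ I_𝔓 ∖ H` exists and, for every prime `ℓ` outside a finite set, `I_𝔓 ∖ H` acts on `E[ℓ]` as `−1`.
* §4b `hasGoodReductionAt_quadraticTwist_of_forall_inertia_smul_eq_neg` — if moreover `H = Stab_{Γ_ℚ}(√d)`, then `E^{(d)}` is good at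
  `v` (X.5.4 sign-equivariance kills the action; §3).

HONEST FRAMING: theorems about elliptic curves over `ℚ` proved from tree theorems (Silverman VII.4.1, VII.7.1 (d)⇒(a), X.5.4; Serre's
determinant); no named fact, no definition, no `sorry`; nothing asserted about BSD; «closes rung: none».  PRESEARCH: Serre–Tate 1968 §2 Cor. 3 /
Kraus 1990 (|Φ_p| = 2 ⟺ ramified quadratic twist of good reduction) — folklore; in the tree only at `p ≥ 5` via Serre's formula.
References: Serre–Tate, Ann. of Math. 88 (1968) §2; Silverman, AEC VII.4.1, VII.7.1, X.5.4; Serre, Invent. Math. 15 (1972) §1.11; Neukirch, ANT I §9.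
-/

set_option autoImplicit false
set_option linter.dupNamespace false

noncomputable section

open scoped Classical NumberField Pointwise

open Field NumberField IsDedekindDomain WeierstrassCurve IsDedekindDomain.HeightOneSpectrum Rat.HeightOneSpectrum
  Literature.NumberTheory.EllipticCurves Literature.NumberTheory.GaloisRepresentations
  Literature.NumberTheory.EllipticCurves.Rank1Residual
  Summit.BirchSwinnertonDyer.Rank1Residual Summit.BirchSwinnertonDyer.Rank1Residual.GaloisImage
  Summit.BirchSwinnertonDyer.Rank1Residual.Additive
  Summit.BirchSwinnertonDyer.BirchSwinnertonDyer.Theorems.ResidualLineRigidity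
  Summit.BirchSwinnertonDyer.BirchSwinnertonDyer.Theorems.SchneiderFreeAdditiveX3.TwistThreeResidualPair
  Summit.BirchSwinnertonDyer.BirchSwinnertonDyer.Theorems.SchneiderFreeAdditiveX3.SemistableTwistLocalAnyLine

namespace Summit.BirchSwinnertonDyer.BirchSwinnertonDyer.Theorems.SchneiderFreeAdditiveX3.QuadraticGoodReductionDescent

/-! ### §1 An involution of determinant one of the `𝔽_ℓ`-plane `E[ℓ]` is `±1` -/

section Involution

variable {W : WeierstrassCurve ℚ} [W.IsElliptic] {ℓ : ℕ} [hℓ : Fact ℓ.Prime]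

omit [W.IsElliptic] in
/-- `2 • P = 0` forces `P = 0` on `E[ℓ]`, `ℓ` odd. [folklore] -/
theorem eq_zero_of_two_smul_eq_zero (hℓ2 : ℓ ≠ 2) {P : geomTorsion W (ℓ : ℤ)} (h2 : (2 : ℤ) • P = 0) : P = 0 := by
  by_contra hP
  have hdvd := dvd_of_zsmul_eq_zero hP h2
  have h2' : (ℓ : ℤ) ∣ ((2 : ℕ) : ℤ) := by exact_mod_cast hdvd
  rw [Int.natCast_dvd_natCast] at h2'
  exact hℓ2 ((Nat.prime_dvd_prime_iff_eq hℓ.out Nat.prime_two).mp h2')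

/-- **An element of `Γ_ℚ` whose square acts trivially on `E[ℓ]` (`ℓ` an odd prime) and whose mod-`ℓ` cyclotomic character is `1`
either fixes `E[ℓ]` pointwise or acts on it as `−1`.**  If `σ P₀ ≠ P₀`, then `Q = σP₀ − P₀ ≠ 0` spans a line on which `σ = −1`; the
line spanned by `R = σP₀ + P₀` (on which `σ = +1`) must coincide with it, since otherwise `E[ℓ] = ⟨Q⟩ ⊕ ⟨R⟩`, `σ` acts on `E[ℓ]/⟨Q⟩`
trivially and the determinant gives `(−1)·1 = χ̄_ℓ(σ) = 1` (generation 28's `intCast_mul_eq_cyclotomic_of_stableLine`), absurd for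
`ℓ ≠ 2`; so `2P₀ = R − Q ∈ ⟨Q⟩` and `σ P₀ = −P₀`; a `σ`-fixed `P₁` then has `P₀ + P₁` moved, whence `2P₁ = 0`.
[cite: Serre1972, §1.11 (det ρ̄_{E,ℓ} = χ̄_ℓ)] -/
theorem smul_eq_neg_of_sq_trivial (hℓ2 : ℓ ≠ 2) {σ : absoluteGaloisGroup ℚ}
    (hsq : ∀ P : geomTorsion W (ℓ : ℤ), σ • σ • P = P) (hχ : modPCyclotomicCharacterZMod ℚ ℓ σ = 1)
    {P₀ : geomTorsion W (ℓ : ℤ)} (hP₀ : σ • P₀ ≠ P₀) : ∀ P : geomTorsion W (ℓ : ℤ), σ • P = -P := by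
  have hℓp : ℓ.Prime := hℓ.out
  have hcard : Nat.card (geomTorsion W (ℓ : ℤ)) = ℓ ^ 2 := Rank1Residual.natCard_geomTorsion W ℓ
  -- Step 1: every point MOVED by `σ` is negated by `σ`
  have hmoved : ∀ P : geomTorsion W (ℓ : ℤ), σ • P ≠ P → σ • P = -P := by
    intro P hP
    set Q : geomTorsion W (ℓ : ℤ) := σ • P - P with hQdef
    set R : geomTorsion W (ℓ : ℤ) := σ • P + P with hRdef
    have hQ0 : Q ≠ 0 := fun h ↦ hP (sub_eq_zero.mp h)
    have hσQ : σ • Q = -Q := by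
      rw [hQdef, smul_sub, hsq, neg_sub]
    have hσR : σ • R = R := by
      rw [hRdef, smul_add, hsq, add_comm]
    have hLQ : Nat.card (AddSubgroup.zmultiples Q) = ℓ := natCard_zmultiples_eq hQ0
    -- `R ∈ ⟨Q⟩`
    have hRmem : R ∈ AddSubgroup.zmultiples Q := by
      by_contra hRQ
      have hR0 : R ≠ 0 := fun h ↦ hRQ (h ▸ (AddSubgroup.zmultiples Q).zero_mem)
      have hLR : Nat.card (AddSubgroup.zmultiples R) = ℓ := natCard_zmultiples_eq hR0
      have hne : AddSubgroup.zmultiples Q ≠ AddSubgroup.zmultiples R := by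
        intro h
        exact hRQ (h ▸ AddSubgroup.mem_zmultiples R)
      obtain ⟨-, hsup⟩ := inf_eq_bot_and_sup_eq_top_of_ne hℓp hcard hLQ hLR hne
      -- `σ = −1` on `⟨Q⟩`, `σ ≡ 1` on `E[ℓ]/⟨Q⟩`
      have ha : ∀ X ∈ AddSubgroup.zmultiples Q, σ • X = (-1 : ℤ) • X := by
        intro X hX
        obtain ⟨k, rfl⟩ := AddSubgroup.mem_zmultiples_iff.mp hX
        rw [smul_comm, hσQ, neg_one_zsmul, smul_neg]
      have hb : ∀ X : geomTorsion W (ℓ : ℤ), σ • X - (1 : ℤ) • X ∈ AddSubgroup.zmultiples Q := by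
        intro X
        have hX : X ∈ AddSubgroup.zmultiples Q ⊔ AddSubgroup.zmultiples R := by rw [hsup]; exact AddSubgroup.mem_top X
        obtain ⟨x, hx, y, hy, rfl⟩ := AddSubgroup.mem_sup.mp hX
        obtain ⟨k, rfl⟩ := AddSubgroup.mem_zmultiples_iff.mp hy
        have hkR : σ • (k • R) = k • R := by rw [smul_comm, hσR]
        have hcalc : σ • (x + k • R) - (1 : ℤ) • (x + k • R) = (-2 : ℤ) • x := by
          rw [one_zsmul, smul_add, ha x hx, hkR]; abel
        rw [hcalc]
        exact AddSubgroup.zsmul_mem _ hx _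
      have hdet := intCast_mul_eq_cyclotomic_of_stableLine σ hLQ ha hb
      rw [hχ, Units.val_one] at hdet
      have h2 : ((2 : ℕ) : ZMod ℓ) = 0 := by
        have h' : ((-1 * 1 : ℤ) : ZMod ℓ) + 1 = 0 := by push_cast; ring
        rw [hdet] at h'
        exact_mod_cast h'
      rw [ZMod.natCast_eq_zero_iff] at h2
      exact hℓ2 ((Nat.prime_dvd_prime_iff_eq hℓp Nat.prime_two).mp h2)
    -- hence `2P = R − Q ∈ ⟨Q⟩`, so `σ(2P) = −2P` and `2(σP + P) = 0`
    have h2P : (2 : ℤ) • P ∈ AddSubgroup.zmultiples Q := by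
      have h : (2 : ℤ) • P = R - Q := by rw [hRdef, hQdef]; abel
      rw [h]
      exact (AddSubgroup.zmultiples Q).sub_mem hRmem (AddSubgroup.mem_zmultiples Q)
    obtain ⟨k, hk⟩ := AddSubgroup.mem_zmultiples_iff.mp h2P
    have hσ2P : σ • ((2 : ℤ) • P) = -((2 : ℤ) • P) := by
      rw [← hk, smul_comm, hσQ, smul_neg]
    have hzero : (2 : ℤ) • (σ • P + P) = 0 := by
      rw [smul_add, ← smul_comm σ (2 : ℤ) P, hσ2P]; abel
    have hRP : σ • P + P = 0 := eq_zero_of_two_smul_eq_zero hℓ2 hzero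
    exact eq_neg_of_add_eq_zero_left hRP
  -- Step 2: a FIXED point is zero (test against `P₀ + P₁`)
  intro P
  by_cases hP : σ • P = P
  · have hP₀' := hmoved P₀ hP₀
    by_cases hsum : σ • (P₀ + P) = P₀ + P
    · -- then `−P₀ + P = P₀ + P`, so `2P₀ = 0`, `P₀ = 0`, contradiction
      exfalso
      rw [smul_add, hP₀', hP] at hsum
      have h' : -P₀ = P₀ := add_right_cancel hsum
      have h2 : (2 : ℤ) • P₀ = 0 := by
        rw [two_zsmul]; nth_rw 1 [← h']; exact neg_add_cancel P₀
      exact hP₀ (by rw [eq_zero_of_two_smul_eq_zero hℓ2 h2, smul_zero])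
    · have h := hmoved _ hsum
      rw [smul_add, hP₀', hP, neg_add] at h
      have h' : P = -P := add_left_cancel h
      have h2 : (2 : ℤ) • P = 0 := by
        rw [two_zsmul]; nth_rw 2 [h']; exact add_neg_cancel P
      rw [eq_zero_of_two_smul_eq_zero hℓ2 h2, smul_zero, neg_zero]
  · exact hmoved P hP

end Involution

/-! ### §2 Inertia elements coming from `Γ_F` act trivially on prime-to-`p` torsion when `E_F` is good above `p` -/

section ThroughF

variable {p : ℕ} [hp : Fact p.Prime] (W : WeierstrassCurve ℚ) [W.IsElliptic]
  (F : Type) [Field F] [NumberField F]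

omit [NumberField F] in
/-- An integer prime to `p` is not in a prime `w ∋ p` of `𝓞 F` (Bézout). [folklore] -/
theorem intCast_not_mem_of_not_dvd {w : HeightOneSpectrum (𝓞 F)} (hw : (p : 𝓞 F) ∈ w.asIdeal) {n : ℤ}
    (hn : ¬ (p : ℤ) ∣ n) : (n : 𝓞 F) ∉ w.asIdeal := by
  intro hmem
  have hpZ : Prime (p : ℤ) := Nat.prime_iff_prime_int.mp hp.out
  obtain ⟨a, b, hab⟩ := (hpZ.irreducible.coprime_iff_not_dvd.mpr hn)
  have h1 : (1 : 𝓞 F) ∈ w.asIdeal := by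
    have h : ((a * p + b * n : ℤ) : 𝓞 F) = 1 := by rw [hab, Int.cast_one]
    rw [← h]
    push_cast
    exact w.asIdeal.add_mem (w.asIdeal.mul_mem_left _ hw) (w.asIdeal.mul_mem_left _ hmem)
  exact w.isPrime.ne_top ((Ideal.eq_top_iff_one _).mpr h1)

/-- **Silverman VII.4.1(a) over `F`, read on `Γ_ℚ`.**  Let `E_F` be good at `w ∋ p`, `𝔓_F` a prime of `\bar ℤ_F` above `w` and
`𝔓 = 𝔓_F ∩ \bar ℤ` its contraction.  Every `τ` in the inertia group `I_𝔓 ≤ Γ_ℚ` that is the restriction of an element of `Γ_F`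
fixes `E[n]` pointwise for `p ∤ n`: its preimage lies in `I_{𝔓_F}` (`comap_inertia_comap_absIntegersMap`), which acts trivially on
`E_F[n]` (`smul_geomTorsion_eq_of_mem_inertia`), and `E[n](ℚ̄) ≃ E_F[n](F̄)` equivariantly (`exists_geomTorsion_baseChange_equiv`).
[cite: SilvermanAEC2009, Prop. VII.4.1(a)] [cite: NeukirchANT1999, Ch. I §9 (9.4)–(9.6)] -/
theorem smul_geomTorsion_eq_of_mem_inertia_of_mem_range {w : HeightOneSpectrum (𝓞 F)} (hw : (p : 𝓞 F) ∈ w.asIdeal)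
    (hgood : (W.baseChange F).HasGoodReductionAt w) {𝔓F : Ideal (absIntegers (𝓞 F) F)} (h𝔓F : 𝔓F ∈ w.primesAbove)
    {n : ℤ} (hn : ¬ (p : ℤ) ∣ n) {τ : absoluteGaloisGroup ℚ}
    (hτI : τ ∈ (𝔓F.comap (absIntegersMap ℚ F)).inertia (absoluteGaloisGroup ℚ))
    (hτr : τ ∈ (absGaloisRestrict ℚ F).range) (P : geomTorsion W n) : τ • P = P := by
  haveI : (W.baseChange F).IsElliptic := inferInstanceAs (W.map (algebraMap ℚ F)).IsElliptic
  obtain ⟨g, rfl⟩ := hτr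
  have hg : g ∈ 𝔓F.inertia (absoluteGaloisGroup F) := by
    rw [← comap_inertia_comap_absIntegersMap ℚ F 𝔓F, Subgroup.mem_comap]
    exact hτI
  have hnw : ((n : 𝓞 F)) ∉ w.asIdeal := intCast_not_mem_of_not_dvd F hw hn
  obtain ⟨t, ht⟩ := CumulativeHeegnerInclusionAtThreeLineBaseChange.exists_geomTorsion_baseChange_equiv W F n
  have h1 : g • t P = t P := (W.baseChange F).smul_geomTorsion_eq_of_mem_inertia hgood hnw h𝔓F hg (t P)
  rw [← ht, resGal_eq_absGaloisRestrict] at h1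
  exact t.injective h1

end ThroughF

/-! ### §3 Néron–Ogg–Shafarevich (d) ⇒ (a) with the inertia group of ONE prime above `v` -/

section NOS

variable {K : Type} [Field K] [NumberField K] (W : WeierstrassCurve K) [W.IsElliptic]

/-- **Criterion of Néron–Ogg–Shafarevich, (d) ⇒ (a), at one prime of `\bar ℤ_K`.**  If for infinitely many `m` prime to `v` the
inertia group `I_{𝔓₀}` of ONE prime `𝔓₀` of `\bar ℤ_K` above `v` fixes `E(K̄)[m]`, then `E` has good reduction at `v`: the inertia
groups of the other primes above `v` are conjugates `σ I_{𝔓₀} σ⁻¹` (`exists_smul_eq_of_mem_primesAbove_holds`,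
`Ideal.conj_mem_inertia_smul_iff`), so the hypothesis of the tree's `hasGoodReductionAt_of_infinite_unramifiedTorsion_primesAbove`
(proved from the local criterion `hasGoodReductionAt_of_infinite_unramifiedTorsion_holds`) holds.
[cite: SilvermanAEC2009, Thm. VII.7.1 ((d) ⇒ (a))] [cite: NeukirchANT1999, Ch. I §9 (9.4)] -/
theorem hasGoodReductionAt_of_infinite_unramifiedTorsion_at (v : HeightOneSpectrum (𝓞 K))
    {𝔓₀ : Ideal (absIntegers (𝓞 K) K)} (h𝔓₀ : 𝔓₀ ∈ v.primesAbove)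
    (hinf : {m : ℕ | (m : 𝓞 K) ∉ v.asIdeal ∧ ∀ τ ∈ 𝔓₀.inertia (absoluteGaloisGroup K),
      ∀ P : geomPoints W, m • P = 0 → τ • P = P}.Infinite) :
    W.HasGoodReductionAt v := by
  refine W.hasGoodReductionAt_of_infinite_unramifiedTorsion_primesAbove
    (W.hasGoodReductionAt_of_infinite_unramifiedTorsion_holds) v (hinf.mono ?_)
  rintro m ⟨hmv, hm⟩
  refine ⟨hmv, fun 𝔓 h𝔓 τ hτ P hP ↦ ?_⟩
  obtain ⟨σ, hσ⟩ := IsDedekindDomain.HeightOneSpectrum.exists_smul_eq_of_mem_primesAbove_holds h𝔓₀ h𝔓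
  have hconj : σ⁻¹ * τ * σ ∈ 𝔓₀.inertia (absoluteGaloisGroup K) := by
    rw [← Ideal.conj_mem_inertia_smul_iff 𝔓₀ σ (σ⁻¹ * τ * σ), hσ]
    simpa only [mul_assoc, mul_inv_cancel, mul_one, mul_inv_cancel_left] using hτ
  have hP' : m • (σ⁻¹ • P) = 0 := by rw [smul_comm, hP, smul_zero]
  have h := hm _ hconj (σ⁻¹ • P) hP'
  rw [mul_smul, mul_smul, smul_inv_smul] at h
  -- `h : σ⁻¹ • τ • P = σ⁻¹ • P`
  exact smul_left_cancel σ⁻¹ h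

end NOS

/-! ### §4 The dichotomy: `E` good at `p`, or inertia acts on almost all `E[ℓ]` through the sign character of `Γ_ℚ / res(Γ_F)` -/

section Dichotomy

variable {p : ℕ} [hp : Fact p.Prime] (W : WeierstrassCurve ℚ) [W.IsElliptic]
  (F : Type) [Field F] [NumberField F]

omit [W.IsElliptic] in
/-- Torsion-subtype reading: `τ` fixes `E[m]` (as a subtype) iff it fixes every `P ∈ E(ℚ̄)` with `m P = O`. [folklore] -/
theorem forall_smul_eq_of_forall_geomTorsion {m : ℕ} {τ : absoluteGaloisGroup ℚ}
    (h : ∀ P : geomTorsion W (m : ℤ), τ • P = P) (P : geomPoints W) (hP : m • P = 0) : τ • P = P := by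
  have hmem : P ∈ geomTorsion W (m : ℤ) := (Submodule.mem_torsionBy_iff _ _).mpr (by rw [natCast_zsmul, hP])
  have := congrArg Subtype.val (h ⟨P, hmem⟩)
  rwa [AddSubgroup.torsionBy.coe_smul] at this

/-- **THE DICHOTOMY.**  `E/ℚ` elliptic, `p` odd, `F` a number field with `E_F` good at `w ∋ p`, `𝔓_F ∣ w` a prime of `\bar ℤ_F` and
`𝔓 = 𝔓_F ∩ \bar ℤ` (a prime of `\bar ℤ` above the place `v ∋ p`); `H = res(Γ_F) ≤ Γ_ℚ` is assumed to satisfy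
`a b ∈ H ↔ (a ∈ H ↔ b ∈ H)` (true when `[F : ℚ] ≤ 2`: `H` has index `≤ 2`).  Then EITHER `E` has good reduction at `v`, OR there
is a finite set `S` of primes such that for every prime `ℓ ∉ S` every `τ ∈ I_𝔓 ∖ H` acts on `E[ℓ]` as `−1` (and every
`τ ∈ I_𝔓 ∩ H` trivially, §2).  Proof: if `I_𝔓` fixes `E[ℓ]` for infinitely many `ℓ`, Néron–Ogg–Shafarevich (§3); otherwise for
almost all `ℓ` some `τ₁ ∈ I_𝔓` moves a point of `E[ℓ]`, `τ₁ ∉ H` (§2), `τ₁² ∈ H` acts trivially, `χ̄_ℓ(τ₁) = 1` (`ℓ ≠ p`,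
inertia at `p` is killed by `χ̄_ℓ`), so `τ₁ = −1` on `E[ℓ]` (§1), and `τ = (τ τ₁⁻¹) τ₁` with `τ τ₁⁻¹ ∈ I_𝔓 ∩ H`.
[cite: SilvermanAEC2009, Thm. VII.7.1, Prop. VII.4.1(a)] [cite: Serre1972, §1.11] [cite: NeukirchANT1999, Ch. I (10.3)] -/
theorem hasGoodReductionAt_or_forall_inertia_smul_eq_neg {w : HeightOneSpectrum (𝓞 F)}
    (hw : (p : 𝓞 F) ∈ w.asIdeal) (hgood : (W.baseChange F).HasGoodReductionAt w)
    {𝔓F : Ideal (absIntegers (𝓞 F) F)} (h𝔓F : 𝔓F ∈ w.primesAbove)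
    {v : HeightOneSpectrum (𝓞 ℚ)} (hpv : ((p : ℕ) : 𝓞 ℚ) ∈ v.asIdeal) (hwv : w.asIdeal.under (𝓞 ℚ) = v.asIdeal)
    (hH : ∀ a b : absoluteGaloisGroup ℚ, a * b ∈ (absGaloisRestrict ℚ F).range ↔
      (a ∈ (absGaloisRestrict ℚ F).range ↔ b ∈ (absGaloisRestrict ℚ F).range)) :
    W.HasGoodReductionAt v ∨
      (∃ σ₀ ∈ (𝔓F.comap (absIntegersMap ℚ F)).inertia (absoluteGaloisGroup ℚ), σ₀ ∉ (absGaloisRestrict ℚ F).range) ∧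
      ∃ S : Set ℕ, S.Finite ∧ ∀ ℓ : ℕ, ℓ.Prime → ℓ ∉ S →
        ∀ τ ∈ (𝔓F.comap (absIntegersMap ℚ F)).inertia (absoluteGaloisGroup ℚ), τ ∉ (absGaloisRestrict ℚ F).range →
          ∀ P : geomTorsion W (ℓ : ℤ), τ • P = -P := by
  set 𝔓 : Ideal (absIntegers (𝓞 ℚ) ℚ) := 𝔓F.comap (absIntegersMap ℚ F) with h𝔓def
  set H : Subgroup (absoluteGaloisGroup ℚ) := (absGaloisRestrict ℚ F).range with hHdef
  have h𝔓 : 𝔓 ∈ v.primesAbove := comap_absIntegersMap_mem_primesAbove hwv h𝔓F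
  haveI : 𝔓.IsPrime := h𝔓.1
  have hpP : p.Prime := hp.out
  -- primes `ℓ ≠ p` are prime to `v`, and `I_𝔓 ∩ H` fixes `E[ℓ]`
  have hℓv : ∀ ℓ : ℕ, ℓ.Prime → ℓ ≠ p → ((ℓ : ℕ) : 𝓞 ℚ) ∉ v.asIdeal := by
    intro ℓ hℓ hℓp hmem
    have hnd : ¬ (p : ℤ) ∣ (ℓ : ℤ) := by
      rw [Int.natCast_dvd_natCast]
      exact fun h ↦ hℓp ((Nat.prime_dvd_prime_iff_eq hpP hℓ).mp h).symm
    exact intCast_not_mem_of_not_dvd (F := ℚ) (w := v) (by exact_mod_cast hpv) hnd (by exact_mod_cast hmem)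
  have hfixH : ∀ ℓ : ℕ, ℓ.Prime → ℓ ≠ p → ∀ τ ∈ 𝔓.inertia (absoluteGaloisGroup ℚ), τ ∈ H →
      ∀ P : geomTorsion W (ℓ : ℤ), τ • P = P := by
    intro ℓ hℓ hℓp τ hτI hτH P
    have hnd : ¬ (p : ℤ) ∣ (ℓ : ℤ) := by
      rw [Int.natCast_dvd_natCast]
      exact fun h ↦ hℓp ((Nat.prime_dvd_prime_iff_eq hpP hℓ).mp h).symm
    exact smul_geomTorsion_eq_of_mem_inertia_of_mem_range W F hw hgood h𝔓F hnd hτI hτH P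
  by_cases hinf : {ℓ : ℕ | ℓ.Prime ∧ ℓ ≠ p ∧ ∀ τ ∈ 𝔓.inertia (absoluteGaloisGroup ℚ),
      ∀ P : geomTorsion W (ℓ : ℤ), τ • P = P}.Infinite
  · -- Néron–Ogg–Shafarevich
    left
    refine hasGoodReductionAt_of_infinite_unramifiedTorsion_at W v h𝔓 (hinf.mono ?_)
    rintro ℓ ⟨hℓ, hℓp, hfix⟩
    exact ⟨hℓv ℓ hℓ hℓp, fun τ hτ P hP ↦ forall_smul_eq_of_forall_geomTorsion W (hfix τ hτ) P hP⟩
  · right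
    have hfin : {ℓ : ℕ | ℓ.Prime ∧ ℓ ≠ p ∧ ∀ τ ∈ 𝔓.inertia (absoluteGaloisGroup ℚ),
        ∀ P : geomTorsion W (ℓ : ℤ), τ • P = P}.Finite := Set.not_infinite.mp hinf
    -- the movers: for every prime `ℓ` outside a finite set, some `τ₁ ∈ I_𝔓 ∖ H` moves a point of `E[ℓ]`
    have hmover : ∀ ℓ : ℕ, ℓ.Prime → ℓ ∉ ({ℓ : ℕ | ℓ.Prime ∧ ℓ ≠ p ∧ ∀ τ ∈ 𝔓.inertia (absoluteGaloisGroup ℚ),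
        ∀ P : geomTorsion W (ℓ : ℤ), τ • P = P} ∪ {p, 2}) →
        ∃ τ₁ ∈ 𝔓.inertia (absoluteGaloisGroup ℚ), τ₁ ∉ H ∧ ∃ P₁ : geomTorsion W (ℓ : ℤ), τ₁ • P₁ ≠ P₁ := by
      intro ℓ hℓ hℓS
      have hℓp : ℓ ≠ p := fun h ↦ hℓS (Or.inr (Or.inl h))
      have hmoved : ∃ τ₁ ∈ 𝔓.inertia (absoluteGaloisGroup ℚ), ∃ P₁ : geomTorsion W (ℓ : ℤ), τ₁ • P₁ ≠ P₁ := by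
        by_contra h
        push Not at h
        exact hℓS (Or.inl ⟨hℓ, hℓp, h⟩)
      obtain ⟨τ₁, hτ₁I, P₁, hP₁⟩ := hmoved
      exact ⟨τ₁, hτ₁I, fun h ↦ hP₁ (hfixH ℓ hℓ hℓp τ₁ hτ₁I h P₁), P₁, hP₁⟩
    refine ⟨?_, {ℓ : ℕ | ℓ.Prime ∧ ℓ ≠ p ∧ ∀ τ ∈ 𝔓.inertia (absoluteGaloisGroup ℚ),
        ∀ P : geomTorsion W (ℓ : ℤ), τ • P = P} ∪ {p, 2},
      hfin.union ((Set.finite_singleton 2).insert p), fun ℓ hℓ hℓS τ hτI hτH ↦ ?_⟩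
    · -- a prime outside the finite exceptional set exists
      obtain ⟨ℓ, hℓmem, hℓS⟩ := (Nat.infinite_setOf_prime.sdiff (hfin.union ((Set.finite_singleton 2).insert p))).nonempty
      obtain ⟨τ₁, hτ₁I, hτ₁H, -⟩ := hmover ℓ hℓmem hℓS
      exact ⟨τ₁, hτ₁I, hτ₁H⟩
    haveI : Fact ℓ.Prime := ⟨hℓ⟩
    have hℓp : ℓ ≠ p := fun h ↦ hℓS (Or.inr (Or.inl h))
    have hℓ2 : ℓ ≠ 2 := fun h ↦ hℓS (Or.inr (Or.inr h))
    obtain ⟨τ₁, hτ₁I, hτ₁H, P₁, hP₁⟩ := hmover ℓ hℓ hℓS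
    -- `τ₁² ∈ I_𝔓 ∩ H` acts trivially; `χ̄_ℓ(τ₁) = 1`
    have hsq : ∀ P : geomTorsion W (ℓ : ℤ), τ₁ • τ₁ • P = P := fun P ↦ by
      rw [← mul_smul]
      exact hfixH ℓ hℓ hℓp _ (Subgroup.mul_mem _ hτ₁I hτ₁I) ((hH τ₁ τ₁).mpr Iff.rfl) P
    have hχ : modPCyclotomicCharacterZMod ℚ ℓ τ₁ = 1 := by
      haveI : NeZero (ℓ : ℚ) := ⟨by exact_mod_cast hℓ.ne_zero⟩
      rw [modPCyclotomicCharacterZMod_eq_modNCyclotomicCharacter]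
      exact modNCyclotomicCharacter_eq_one_of_mem_inertia
        (Literature.NumberTheory.GaloisRepresentations.natCast_not_mem_of_mem_primesAbove ℚ (hℓv ℓ hℓ hℓp) h𝔓) hτ₁I
    have hneg : ∀ P : geomTorsion W (ℓ : ℤ), τ₁ • P = -P := smul_eq_neg_of_sq_trivial hℓ2 hsq hχ hP₁
    -- `τ = (τ τ₁⁻¹) τ₁` with `τ τ₁⁻¹ ∈ I_𝔓 ∩ H`
    intro P
    have hmemI : τ * τ₁⁻¹ ∈ 𝔓.inertia (absoluteGaloisGroup ℚ) := Subgroup.mul_mem _ hτI (Subgroup.inv_mem _ hτ₁I)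
    have hmemH : τ * τ₁⁻¹ ∈ H := by
      rw [hH, Subgroup.inv_mem_iff]
      exact ⟨fun h ↦ absurd h hτH, fun h ↦ absurd h hτ₁H⟩
    have h := hfixH ℓ hℓ hℓp _ hmemI hmemH (τ₁ • P)
    rw [mul_smul, inv_smul_smul] at h
    rw [h, hneg]

end Dichotomy

/-! ### §4b The twist by the quadratic character of `H` kills the sign action -/

section Twist

variable {p : ℕ} [hp : Fact p.Prime] (W : WeierstrassCurve ℚ) [W.IsElliptic]
  (F : Type) [Field F] [NumberField F]

/-- **If inertia acts on almost all `E[ℓ]` through the sign character of `Γ_ℚ/H` and `H = Stab(√d)`, then `E^{(d)}` is good at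
`v`.**  On `E^{(d)}[ℓ] ≃ E[ℓ]` (sign-equivariant, Silverman X.5.4: `e(τT) = ±τ e(T)` according as `τ√d = ±√d`) every `τ ∈ I_𝔓`
acts trivially: `τ ∈ H` fixes `E[ℓ]` (§2) and `√d`; `τ ∉ H` negates both.  Néron–Ogg–Shafarevich (§3) concludes.
[cite: SilvermanAEC2009, X.5 Cor. 5.4, Thm. VII.7.1] -/
theorem hasGoodReductionAt_quadraticTwist_of_forall_inertia_smul_eq_neg {w : HeightOneSpectrum (𝓞 F)}
    (hw : (p : 𝓞 F) ∈ w.asIdeal) (hgood : (W.baseChange F).HasGoodReductionAt w)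
    {𝔓F : Ideal (absIntegers (𝓞 F) F)} (h𝔓F : 𝔓F ∈ w.primesAbove)
    {v : HeightOneSpectrum (𝓞 ℚ)} (hpv : ((p : ℕ) : 𝓞 ℚ) ∈ v.asIdeal) (hwv : w.asIdeal.under (𝓞 ℚ) = v.asIdeal)
    {S : Set ℕ} (hS : S.Finite)
    (hneg : ∀ ℓ : ℕ, ℓ.Prime → ℓ ∉ S →
      ∀ τ ∈ (𝔓F.comap (absIntegersMap ℚ F)).inertia (absoluteGaloisGroup ℚ), τ ∉ (absGaloisRestrict ℚ F).range →
        ∀ P : geomTorsion W (ℓ : ℤ), τ • P = -P)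
    {d : ℚ} (hd0 : d ≠ 0)
    (hHd : ∀ τ : absoluteGaloisGroup ℚ, τ ∈ (absGaloisRestrict ℚ F).range ↔ τ • geomSqrt d = geomSqrt d) :
    (W.quadraticTwist d).HasGoodReductionAt v := by
  set 𝔓 : Ideal (absIntegers (𝓞 ℚ) ℚ) := 𝔓F.comap (absIntegersMap ℚ F) with h𝔓def
  have h𝔓 : 𝔓 ∈ v.primesAbove := comap_absIntegersMap_mem_primesAbove hwv h𝔓F
  have hpP : p.Prime := hp.out
  haveI := W.isElliptic_quadraticTwist hd0
  refine hasGoodReductionAt_of_infinite_unramifiedTorsion_at (W.quadraticTwist d) v h𝔓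
    ((Nat.infinite_setOf_prime.sdiff (hS.union (Set.finite_singleton p))).mono ?_)
  rintro ℓ ⟨hℓ, hℓS⟩
  have hℓ' : ℓ.Prime := hℓ
  have hℓS' : ℓ ∉ S := fun h ↦ hℓS (Or.inl h)
  have hℓp : ℓ ≠ p := fun h ↦ hℓS (Or.inr h)
  have hnd : ¬ (p : ℤ) ∣ (ℓ : ℤ) := by
    rw [Int.natCast_dvd_natCast]
    exact fun h ↦ hℓp ((Nat.prime_dvd_prime_iff_eq hpP hℓ').mp h).symm
  refine ⟨fun hmem ↦ intCast_not_mem_of_not_dvd (F := ℚ) (w := v) (by exact_mod_cast hpv) hnd (by exact_mod_cast hmem),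
    fun τ hτ P hP ↦ forall_smul_eq_of_forall_geomTorsion (W.quadraticTwist d) (fun T ↦ ?_) P hP⟩
  obtain ⟨e, hpos, hneg'⟩ := exists_signEquiv_of_twist (W := W) (Wd := W.quadraticTwist d) (p := ℓ) hd0 1 (one_smul _ _)
  apply e.injective
  by_cases hτH : τ ∈ (absGaloisRestrict ℚ F).range
  · rw [hpos τ ((hHd τ).mp hτH), smul_geomTorsion_eq_of_mem_inertia_of_mem_range W F hw hgood h𝔓F hnd hτ hτH]
  · rw [hneg' τ (fun h ↦ hτH ((hHd τ).mpr h)), hneg ℓ hℓ' hℓS' τ hτ hτH, neg_neg]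

end Twist

end Summit.BirchSwinnertonDyer.BirchSwinnertonDyer.Theorems.SchneiderFreeAdditiveX3.QuadraticGoodReductionDescent

end
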